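import Summits.CriticalPhenomena.PercolationContinuityZ3.Theorems.PercNearOneGluingNoHeavyLowerTailKnQuestion8CoefficientwiseCoreClassKernelMixJoinMatching

/-!
# The bi-discipline inequality (core of the single-cycle lemma N₂)

Support file (`--supports stmt-CriticalPhenomena-4575`, closed), prover `prim-cplus-coupling` (gen 66).  No definitions, no notations,
no named facts, no sorries; standard axioms.  Memo `prim-cplus-coupling/A5-COUPLING-gen66.md` §3 (LEMMA C).

Context.  The two-type theorem (JP / (X2)) for bouquets of cycles is proved (memo gen 66 §2) by a canonical recursive
two-stage matching whose single-cycle factors are *bi-disciplined* Kleitman bijections: the full word `R^L` of a cycle may only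
be the image of a source that is blue at BOTH hub edges.  Their existence is, by Hall, the strict Kleitman inequality
`#(U ∩ V) + 1 ≤ #(U ∩ cV)` for every nonempty exact level `V ≠ NF` of the cycle and every nonempty upper set `U` avoiding
`y⁰ = B R^{L-2} B`.  Slicing the cycle words by their two hub letters reduces this to the following statement about the Boolean
lattice of INTERIOR edge sets (`Finset α`), proved here from two instances of Kleitman's inequality in mirror form
(`JoinMatching.kleitman_mirror`) and a count of the top word:

THEOREM `bidiscipline_core`.  For upper families `P, Q ⊆ R` with `R` nonempty and lower families `W₁, W₂ ⊆ W₀` with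
`∅ ∈ W₁`, `∅ ∈ W₂`,
  `#(P ∩ W₁) + #(Q ∩ W₂) + 1 ≤ #{x ∈ P | xᶜ ∈ W₂} + #{x ∈ Q | xᶜ ∈ W₁} + #{x ∈ R | xᶜ ∈ W₀}`.

(Dictionary: `P, Q, R` = the `RB`, `BR`, `RR` hub-slices of `U`; `W₁ = V_RB`, `W₂ = V_BR`, `W₀ = V_BB`; the `RR`-slice of an exact
`V ≠ NF` is empty and complementation swaps the hub patterns `RB ↔ BR`, `BB ↔ RR`.)
[cite: KozmaNitzan2024, Questions 8–9 (§5.5 p. 36) (context); Harris 1960; Kleitman 1966]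
-/

namespace Summit.CriticalPhenomena.PercolationContinuityZ3.Theorems.Coefficientwise.BiDiscipline

open Finset JoinMatching

variable {α : Type*} [Fintype α] [DecidableEq α]

omit [DecidableEq α] in
/-- A nonempty upper family of subsets of a finite type contains the top set `univ`. -/
theorem univ_mem_of_isUpperSet {U : Finset (Finset α)} (hU : IsUpperSet (U : Set (Finset α)))
    (hne : U.Nonempty) : (univ : Finset α) ∈ U := by
  obtain ⟨x, hx⟩ := hne
  exact mem_coe.mp (hU (subset_univ x) (mem_coe.mpr hx))

/-- **The bi-discipline inequality** (abstract core of the single-cycle lemma N₂, memo gen 66 §3).  For upper families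
`P, Q ⊆ R` of subsets of a finite set with `R` nonempty and upper, and lower families `W₁, W₂ ⊆ W₀` containing `∅`,
`#(P ∩ W₁) + #(Q ∩ W₂) + 1 ≤ #{x ∈ P | xᶜ ∈ W₂} + #{x ∈ Q | xᶜ ∈ W₁} + #{x ∈ R | xᶜ ∈ W₀}`.
Proof: Kleitman in mirror form for `(P, W₁)` and `(Q, W₂)`, the inclusions
`{x ∈ P | xᶜ ∈ W₁} ∪ {x ∈ Q | xᶜ ∈ W₂} ⊆ {x ∈ R | xᶜ ∈ W₀}` and
`{x ∈ P | xᶜ ∈ W₁} ∩ {x ∈ Q | xᶜ ∈ W₂} ⊆ {x ∈ P | xᶜ ∈ W₂}`, and the top set `univ`, whose complement `∅` lies in every `Wᵢ`.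
[cite: KozmaNitzan2024, Questions 8–9 (§5.5 p. 36) (context); Harris 1960; Kleitman 1966] -/
theorem bidiscipline_core (P Q R W₁ W₂ W₀ : Finset (Finset α))
    (hP : IsUpperSet (P : Set (Finset α))) (hQ : IsUpperSet (Q : Set (Finset α)))
    (hR : IsUpperSet (R : Set (Finset α)))
    (hW₁ : IsLowerSet (W₁ : Set (Finset α))) (hW₂ : IsLowerSet (W₂ : Set (Finset α)))
    (hPR : P ⊆ R) (hQR : Q ⊆ R) (h₁₀ : W₁ ⊆ W₀) (h₂₀ : W₂ ⊆ W₀)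
    (he₁ : (∅ : Finset α) ∈ W₁) (he₂ : (∅ : Finset α) ∈ W₂) (hRne : R.Nonempty) :
    (P ∩ W₁).card + (Q ∩ W₂).card + 1 ≤
      (P.filter (fun x => xᶜ ∈ W₂)).card + (Q.filter (fun x => xᶜ ∈ W₁)).card +
        (R.filter (fun x => xᶜ ∈ W₀)).card := by
  classical
  set PA : Finset (Finset α) := P.filter (fun x => xᶜ ∈ W₁) with hPA
  set QB : Finset (Finset α) := Q.filter (fun x => xᶜ ∈ W₂) with hQB
  set X₂ : Finset (Finset α) := P.filter (fun x => xᶜ ∈ W₂) with hX₂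
  set Y₁ : Finset (Finset α) := Q.filter (fun x => xᶜ ∈ W₁) with hY₁
  set Z : Finset (Finset α) := R.filter (fun x => xᶜ ∈ W₀) with hZ
  -- two Kleitman instances (each type into its own mirror)
  have ka : (P ∩ W₁).card ≤ PA.card := kleitman_mirror P W₁ hP hW₁
  have kb : (Q ∩ W₂).card ≤ QB.card := kleitman_mirror Q W₂ hQ hW₂
  -- inclusions
  have hunion : PA ∪ QB ⊆ Z := by
    intro x hx
    rcases mem_union.mp hx with h | h
    · obtain ⟨hxP, hxW⟩ := mem_filter.mp h
      exact mem_filter.mpr ⟨hPR hxP, h₁₀ hxW⟩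
    · obtain ⟨hxQ, hxW⟩ := mem_filter.mp h
      exact mem_filter.mpr ⟨hQR hxQ, h₂₀ hxW⟩
  have hinter : PA ∩ QB ⊆ X₂ := by
    intro x hx
    obtain ⟨h1, h2⟩ := mem_inter.mp hx
    exact mem_filter.mpr ⟨(mem_filter.mp h1).1, (mem_filter.mp h2).2⟩
  have hZcard : (PA ∪ QB).card ≤ Z.card := card_le_card hunion
  have hX₂card : (PA ∩ QB).card ≤ X₂.card := card_le_card hinter
  -- the top word `univ`: its complement `∅` lies in `W₁, W₂, W₀`
  have he₀ : (∅ : Finset α) ∈ W₀ := h₁₀ he₁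
  have cu : (univ : Finset α)ᶜ = ∅ := compl_univ
  have htopZ : (univ : Finset α) ∈ Z :=
    mem_filter.mpr ⟨univ_mem_of_isUpperSet hR hRne, by rw [cu]; exact he₀⟩
  have hZpos : 1 ≤ Z.card := card_pos.mpr ⟨_, htopZ⟩
  have hX₂pos : P.Nonempty → 1 ≤ X₂.card := fun hne =>
    card_pos.mpr ⟨_, mem_filter.mpr ⟨univ_mem_of_isUpperSet hP hne, by rw [cu]; exact he₂⟩⟩
  have hY₁pos : Q.Nonempty → 1 ≤ Y₁.card := fun hne =>
    card_pos.mpr ⟨_, mem_filter.mpr ⟨univ_mem_of_isUpperSet hQ hne, by rw [cu]; exact he₁⟩⟩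
  -- key count: #(PA ∩ QB) + 1 + #(PA ∪ QB) ≤ #X₂ + #Y₁ + #Z
  have key : (PA ∩ QB).card + 1 + (PA ∪ QB).card ≤ X₂.card + Y₁.card + Z.card := by
    by_cases hQe : Q.Nonempty
    · have := hY₁pos hQe
      omega
    · have hQ0 : Q = ∅ := not_nonempty_iff_eq_empty.mp hQe
      have hQB0 : QB = ∅ := by rw [hQB, hQ0, filter_empty]
      rw [hQB0, inter_empty, union_empty, card_empty]
      by_cases hPe : P.Nonempty
      · have h1 := hX₂pos hPe
        have h2 : PA.card ≤ Z.card := by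
          have : PA ⊆ Z := fun x hx => hunion (mem_union_left _ hx)
          exact card_le_card this
        omega
      · have hP0 : P = ∅ := not_nonempty_iff_eq_empty.mp hPe
        have hPA0 : PA = ∅ := by rw [hPA, hP0, filter_empty]
        rw [hPA0, card_empty]
        omega
  -- assemble with inclusion–exclusion  #(PA ∪ QB) + #(PA ∩ QB) = #PA + #QB
  have ie : (PA ∪ QB).card + (PA ∩ QB).card = PA.card + QB.card := card_union_add_card_inter PA QB
  omega

end Summit.CriticalPhenomena.PercolationContinuityZ3.Theorems.Coefficientwise.BiDiscipline
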